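import Mathlib
import Literature.Computability.Complexity.ExtMonotoneGRankSupport
import Literature.LinearAlgebra.Matrix.RankMinors

/-!
# Route ConvexRankGates — crux `LinAlgGateBlind` (stmt-PneNP-10681), support:
# KÖNIG gates are GRANK gates of the same dimension (Edmonds: term rank = generic rank)

Line `konig-atoms-cancellation-split` of the crux chain isolates the *cancellation-free layer* of
the GRANK basis: a KÖNIG gate of dimension `d` with pattern data `P₀, Pᵢ ⊆ [d] × [d]` and threshold
`θ` accepts `v` iff the OR-pattern `P₀ ∪ ⋃_{vᵢ = 1} Pᵢ` contains `θ` cells in pairwise distinct rows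
and pairwise distinct columns (a `θ`-matching). The line card justifies the class by Edmonds'
theorem (J. Edmonds, *Systems of distinct representatives and linear algebra*, J. Res. NBS 71B
(1967), §5 Thm 1): with GENERIC entries on the patterns the generic rank is the term rank. This
file proves that statement in gate form, definition-free:

* `exists_perm_forall_ne_zero_of_det_ne_zero` — a non-zero determinant has a non-zero Leibniz
  term (a permutation all of whose cells are non-zero).
* `symbolicMatrix_entry_eq_zero` — an entry of `K₀ + Σ_{vᵢ=1} Xᵢ Kᵢ` vanishes off the OR-pattern
  of the supports (so GRANK ≤ KÖNIG pointwise: Frobenius–Kőnig, easy direction).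
* `eval_killVars`, `symbolicPolyMatrix_map_eval`, `det_submatrix_symbolicMatrix_ne_zero_of_eval` —
  a minor of the generic symbolic matrix is non-zero as soon as its numerical specialisation
  `Xᵢ := [vᵢ]` is non-zero.
* `isGRankGate_of_matchingGate` — **KÖNIG_s ⊆ GRANK_s**: every gate whose acceptance is
  "`θ`-matching in the OR-pattern" (the line's `IsKonigGate`, unfolded) is a GRANK gate of the same
  dimension, over the field `ℚ(t)` with one indeterminate `t_{o,a,w}` per (owner, cell): take
  `K₀ = (t_{0,a,w} [(a,w) ∈ P₀])`, `Kᵢ = (t_{i,a,w} [(a,w) ∈ Pᵢ])`. A `θ`-matching gives a non-zero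
  `θ × θ` minor by specialising every indeterminate to the indicator of "matching cell with its
  chosen owner" (the minor becomes the identity matrix); a non-zero minor gives a matching by the
  Leibniz expansion.

Consequences for the line (stated there, not here): `IsKonigGate s g → IsGRankGate s g`, hence
`IsHallCoverGate s g → IsGRankGate s g` by Kőnig–Egerváry (`konigDuality_pattern`,
`Theorems/ConvexRankGatesLinAlgGateBlindKonigDuality.lean`); so the line's `stub_sgHallCover` is a
special case of the picked line's `stub_sgGRank`, and a single König gate of dimension `m^c`
computing CLIQUE is excluded by the crux exactly like a single GRANK gate.
-/

namespace Summit.PneNP.PneNP.Theorems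

open Finset MvPolynomial Literature.Computability.Complexity

/-- A non-zero determinant has a non-zero Leibniz term: some permutation `σ` all of whose cells
`(σ j, j)` carry non-zero entries. [folklore] -/
theorem exists_perm_forall_ne_zero_of_det_ne_zero {R : Type*} [CommRing R] {ι : Type*} [Fintype ι]
    [DecidableEq ι] (M : Matrix ι ι R) (h : M.det ≠ 0) : ∃ σ : Equiv.Perm ι, ∀ j, M (σ j) j ≠ 0 := by
  rw [Matrix.det_apply'] at h
  obtain ⟨σ, -, hσ⟩ := Finset.exists_ne_zero_of_sum_ne_zero h
  exact ⟨σ, fun j hj => right_ne_zero_of_mul hσ (Finset.prod_eq_zero (Finset.mem_univ j) hj)⟩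

section Symbolic

variable {F : Type*} [Field F] {n d : ℕ}

/-- An entry of the symbolic matrix `K₀ + Σ_{vᵢ = 1} Xᵢ Kᵢ` vanishes at a cell where `K₀` and every
switched-on `Kᵢ` vanish (GRANK ≤ KÖNIG pointwise; Frobenius–Kőnig, easy direction). [folklore] -/
theorem symbolicMatrix_entry_eq_zero (K₀ : Matrix (Fin d) (Fin d) F)
    (K : Fin n → Matrix (Fin d) (Fin d) F) (v : Fin n → Bool) {a b : Fin d} (h0 : K₀ a b = 0)
    (h : ∀ i, v i = true → K i a b = 0) : symbolicMatrix K₀ K v a b = 0 := by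
  simp only [symbolicMatrix, Matrix.add_apply, Matrix.map_apply, h0, map_zero, zero_add]
  rw [Matrix.sum_apply]
  refine Finset.sum_eq_zero fun i _ => ?_
  by_cases hv : v i = true
  · simp [hv, Matrix.smul_apply, Matrix.map_apply, h i hv]
  · simp [hv]

/-- Killing the unselected variables and then setting every variable to `1` is the numerical
specialisation `Xᵢ := [vᵢ]`. [folklore] -/
theorem eval_killVars (v : Fin n → Bool) (p : MvPolynomial (Fin n) F) :
    MvPolynomial.eval (fun _ => (1 : F)) (killVars v p) =
      MvPolynomial.eval (fun i => if v i then (1 : F) else 0) p := by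
  have key : (MvPolynomial.eval fun _ => (1 : F)).comp
      (killVars (F := F) v : MvPolynomial (Fin n) F →ₐ[F] MvPolynomial (Fin n) F).toRingHom
      = MvPolynomial.eval fun i => if v i then (1 : F) else 0 := by
    refine MvPolynomial.ringHom_ext (fun a => ?_) (fun i => ?_)
    · show MvPolynomial.eval _ (killVars v (C a)) = MvPolynomial.eval _ (C a)
      simp [killVars, MvPolynomial.algebraMap_eq]
    · show MvPolynomial.eval _ (killVars v (X i)) = MvPolynomial.eval _ (X i)
      rw [killVars_X]
      split_ifs with h <;> simp [h]
  rw [← key]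
  rfl

/-- The numerical specialisation `Xᵢ := [vᵢ]` of the generic symbolic matrix `K₀ + Σᵢ Xᵢ Kᵢ` is
`K₀ + Σ_{vᵢ = 1} Kᵢ`. [folklore] -/
theorem symbolicPolyMatrix_map_eval (K₀ : Matrix (Fin d) (Fin d) F)
    (K : Fin n → Matrix (Fin d) (Fin d) F) (v : Fin n → Bool) :
    (symbolicPolyMatrix K₀ K).map (MvPolynomial.eval fun i => if v i then (1 : F) else 0) =
      K₀ + ∑ i, if v i then K i else 0 := by
  ext a b
  simp only [symbolicPolyMatrix, Matrix.map_apply, Matrix.add_apply, Matrix.sum_apply,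
    Matrix.smul_apply, smul_eq_mul, map_add, map_sum, map_mul, eval_C, eval_X]
  congr 1
  refine Finset.sum_congr rfl fun i _ => ?_
  split_ifs <;> simp

/-- **A minor of the symbolic matrix is non-zero as soon as its numerical specialisation is**: if the
`(r, c)`-minor of `K₀ + Σ_{vᵢ=1} Kᵢ` (entries in `F`) is non-zero then so is the `(r, c)`-minor of
`K₀ + Σ_{vᵢ=1} Xᵢ Kᵢ` over `Frac F[X]` (specialisation is a ring map on `F[X]`). [folklore] -/
theorem det_submatrix_symbolicMatrix_ne_zero_of_eval (K₀ : Matrix (Fin d) (Fin d) F)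
    (K : Fin n → Matrix (Fin d) (Fin d) F) (v : Fin n → Bool) {ι : Type*} [Fintype ι]
    [DecidableEq ι] (r c : ι → Fin d)
    (h : ((K₀ + ∑ i, if v i then K i else 0).submatrix r c).det ≠ 0) :
    ((symbolicMatrix K₀ K v).submatrix r c).det ≠ 0 := by
  rw [Ne, det_submatrix_symbolicMatrix_eq_zero_iff]
  intro h0
  apply h
  have h1 := congrArg (MvPolynomial.eval fun _ => (1 : F)) h0
  rw [eval_killVars, map_zero, RingHom.map_det, RingHom.mapMatrix_apply, ← Matrix.submatrix_map,
    symbolicPolyMatrix_map_eval] at h1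
  exact h1

end Symbolic

/-- **KÖNIG gates are GRANK gates of the same dimension** (Edmonds 1967, §5 Thm 1, in gate form).
Let `f : {0,1}ⁿ → {0,1}` accept `v` iff the OR-pattern `P₀ ∪ ⋃_{vᵢ=1} Pᵢ ⊆ [d] × [d]` contains `θ`
cells with pairwise distinct rows and pairwise distinct columns (the line's `IsKonigGate`, with
`HasMatching` / `orPattern` unfolded). Then `⟨n, f⟩` is a GRANK gate of every dimension `s ≥ d`: over
`F = ℚ(t_{o,a,w} : o ∈ {0} ⊔ [n], (a,w) ∈ [d]²)` put `K₀ = (t_{0,a,w}·[(a,w) ∈ P₀])_{a,w}` and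
`Kᵢ = (t_{i,a,w}·[(a,w) ∈ Pᵢ])_{a,w}`; then `θ ≤ rank (K₀ + Σ_{vᵢ=1} Xᵢ Kᵢ)` iff the OR-pattern at
`v` has a `θ`-matching. [folklore] -/
theorem isGRankGate_of_matchingGate : ∀ {n d s θ : ℕ}, d ≤ s → ∀ (P₀ : Set (Fin d × Fin d))
    (P : Fin n → Set (Fin d × Fin d)) {f : (Fin n → Bool) → Bool},
    (∀ v, f v = true ↔ ∃ (r c : Fin θ → Fin d), Function.Injective r ∧ Function.Injective c ∧
        ∀ j, (r j, c j) ∈ P₀ ∨ ∃ i, v i = true ∧ (r j, c j) ∈ P i) → IsGRankGate s ⟨n, f⟩ := by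
  intro n d s θ hd P₀ P f hf
  classical
  -- generic entries: one indeterminate per (owner, cell); owner `none` is the constant pattern `P₀`
  let R₀ : Type := MvPolynomial (Option (Fin n) × (Fin d × Fin d)) ℚ
  let L : Type := FractionRing R₀
  let ι : R₀ →+* L := algebraMap R₀ L
  have hι : Function.Injective ι := IsFractionRing.injective R₀ L
  let K₀' : Matrix (Fin d) (Fin d) R₀ :=
    Matrix.of fun a b => P₀.indicator (fun x => (X (none, x) : R₀)) (a, b)
  let K' : Fin n → Matrix (Fin d) (Fin d) R₀ := fun i =>
    Matrix.of fun a b => (P i).indicator (fun x => (X (some i, x) : R₀)) (a, b)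
  refine ⟨L, inferInstance, d, θ, hd, K₀'.map ι, fun i => (K' i).map ι, fun v => ?_⟩
  show f v = true ↔ _
  rw [hf v]
  constructor
  · -- a `θ`-matching in the OR-pattern gives a non-zero `θ × θ` minor
    rintro ⟨r, c, hr, hc, hcell⟩
    refine (Literature.LinearAlgebra.Matrix.le_rank_iff_exists_det_submatrix_ne_zero _).2
      ⟨r, c, ?_⟩
    apply det_submatrix_symbolicMatrix_ne_zero_of_eval
    -- pull the numerical matrix back to `R₀`
    have hmap : ((K₀'.map ι + ∑ i, if v i then (K' i).map ι else 0) :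
        Matrix (Fin d) (Fin d) L) = (K₀' + ∑ i, if v i then K' i else 0).map ι := by
      ext a b
      simp only [Matrix.add_apply, Matrix.map_apply, Matrix.sum_apply, map_add, map_sum]
      congr 1
      refine Finset.sum_congr rfl fun i _ => ?_
      split_ifs <;> simp [Matrix.map_apply]
    rw [hmap, Matrix.submatrix_map, ← RingHom.mapMatrix_apply, ← RingHom.map_det]
    refine (map_ne_zero_iff _ hι).2 ?_
    -- choose an owner for every matching cell
    have hown : ∀ j, ∃ o : Option (Fin n), (o = none ∧ (r j, c j) ∈ P₀) ∨
        ∃ i, o = some i ∧ v i = true ∧ (r j, c j) ∈ P i := fun j => by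
      rcases hcell j with h | ⟨i, hi, h⟩
      · exact ⟨none, Or.inl ⟨rfl, h⟩⟩
      · exact ⟨some i, Or.inr ⟨i, rfl, hi, h⟩⟩
    choose own hown using hown
    -- specialise `t_{o,a,w} := [∃ j, (o,a,w) = (own j, r j, c j)]`: the minor becomes the identity
    let ω : Option (Fin n) × (Fin d × Fin d) → ℚ := fun p =>
      if ∃ j, own j = p.1 ∧ r j = p.2.1 ∧ c j = p.2.2 then 1 else 0
    have hω : ∀ (o : Option (Fin n)) (j j' : Fin θ),
        ω (o, (r j, c j')) = if j = j' ∧ own j = o then 1 else 0 := by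
      intro o j j'
      simp only [ω]
      congr 1
      refine propext ⟨?_, ?_⟩
      · rintro ⟨j'', h1, h2, h3⟩
        obtain rfl : j'' = j := hr h2
        exact ⟨hc h3, h1⟩
      · rintro ⟨rfl, h⟩
        exact ⟨j, h, rfl, rfl⟩
    intro h0
    have h1 := congrArg (MvPolynomial.eval ω) h0
    rw [RingHom.map_det, map_zero] at h1
    -- entries of the specialised minor
    have hsum : ∀ a b, (∑ i, if v i then K' i else (0 : Matrix (Fin d) (Fin d) R₀)) a b =
        ∑ i, if v i then K' i a b else 0 := by
      intro a b
      rw [Matrix.sum_apply]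
      refine Finset.sum_congr rfl fun i _ => ?_
      split_ifs <;> rfl
    have hK₀ : ∀ a b, MvPolynomial.eval ω (K₀' a b) = if (a, b) ∈ P₀ then ω (none, (a, b)) else 0 := by
      intro a b
      simp only [K₀', Matrix.of_apply, Set.indicator_apply, apply_ite (MvPolynomial.eval ω), eval_X,
        map_zero]
    have hK' : ∀ i a b, MvPolynomial.eval ω (K' i a b) =
        if (a, b) ∈ P i then ω (some i, (a, b)) else 0 := by
      intro i a b
      simp only [K', Matrix.of_apply, Set.indicator_apply, apply_ite (MvPolynomial.eval ω), eval_X,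
        map_zero]
    have hentry : ∀ j j', (RingHom.mapMatrix (MvPolynomial.eval ω))
        ((K₀' + ∑ i, if v i then K' i else 0).submatrix r c) j j' =
          (if (r j, c j') ∈ P₀ then ω (none, (r j, c j')) else 0) +
            ∑ i, if v i then (if (r j, c j') ∈ P i then ω (some i, (r j, c j')) else 0) else 0 := by
      intro j j'
      rw [RingHom.mapMatrix_apply, Matrix.map_apply, Matrix.submatrix_apply, Matrix.add_apply, hsum,
        map_add, map_sum, hK₀]
      congr 1
      refine Finset.sum_congr rfl fun i _ => ?_
      by_cases hvi : v i = true
      · simp [hvi, hK']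
      · simp [hvi]
    have hone : (RingHom.mapMatrix (MvPolynomial.eval ω))
        ((K₀' + ∑ i, if v i then K' i else 0).submatrix r c) = 1 := by
      ext j j'
      rw [hentry]
      simp only [hω]
      by_cases hjj : j = j'
      · subst hjj
        rw [Matrix.one_apply_eq]
        rcases hown j with ⟨ho, hP⟩ | ⟨i₀, ho, hv, hP⟩
        · -- owner `P₀`: the constant cell contributes `1`, no input owns the cell
          simp [ho, hP]
        · -- owner `i₀`: exactly the `i₀`-th summand contributes `1`
          rw [Finset.sum_eq_single i₀]
          · simp [ho, hP, hv]
          · intro i _ hi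
            have hne : own j ≠ some i := by
              rw [ho]
              exact fun h => hi (Option.some_injective _ h).symm
            simp [hne]
          · simp
      · rw [Matrix.one_apply_ne hjj]
        simp [hjj]
    rw [hone, Matrix.det_one] at h1
    exact one_ne_zero h1
  · -- a non-zero `θ × θ` minor gives a `θ`-matching (Leibniz expansion)
    intro hrank
    obtain ⟨r, c, hr, hc, hdet⟩ :=
      Literature.LinearAlgebra.Matrix.exists_det_submatrix_ne_zero_of_le_rank _ hrank
    obtain ⟨σ, hσ⟩ := exists_perm_forall_ne_zero_of_det_ne_zero _ hdet
    refine ⟨r ∘ σ, c, hr.comp σ.injective, hc, fun j => ?_⟩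
    by_contra hnot
    simp only [not_or, not_exists, not_and] at hnot
    apply hσ j
    rw [Matrix.submatrix_apply]
    have h1 : (r (σ j), c j) ∉ P₀ := hnot.1
    have h2 : ∀ i, v i = true → (r (σ j), c j) ∉ P i := hnot.2
    apply symbolicMatrix_entry_eq_zero
    · simp [K₀', Set.indicator_of_notMem h1]
    · intro i hi
      simp [K', Set.indicator_of_notMem (h2 i hi)]

end Summit.PneNP.PneNP.Theorems
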